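import Summits.BirchSwinnertonDyer.BirchSwinnertonDyer.Theorems.SemiOrdinaryEisensteinDescentLeafOfSigmaTowerFree
import HarnessLib

/-!
# SKETCH (crux workfile, NOT a proposal) — the pen's Option A of `TOWER-IDLE-w2g3.md` §3, kernel-certified:
# restated Ko′ / J′ (the items' texts with the binder `AdditiveThree.TowerSurjThree W →` deleted), the tower-free
# kernel item, the re-glue of Ko's split, NT as a derived statement, and `closes′` — every closer a ONE-LINER over
# landed theorems (p594241, p594519, p594878). Width seat bsd-wall-soed-p2-w2 g3, 2026-08-28. The `def`s below are
# LOCAL MIRRORS for elaboration only (the real decls are the pen's `route edit`); nothing here is an item or a fact.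
-/

set_option autoImplicit false
set_option linter.dupNamespace false

noncomputable section

open scoped Classical

namespace Summit.BirchSwinnertonDyer.BirchSwinnertonDyer.Cruxes.WildKolyvaginUpperAtThree.SketchRestateTowerFree

open WeierstrassCurve NumberField
  Literature.NumberTheory.EllipticCurves
  Literature.NumberTheory.EllipticCurves.ModularForms
  Summit.BirchSwinnertonDyer.Rank1Residual
  Summit.BirchSwinnertonDyer.Rank1Residual.Additive
  Summit.BirchSwinnertonDyer.Rank1Residual.X11b
  Summit.BirchSwinnertonDyer.Rank1Residual.X11b.Three
  Summit.BirchSwinnertonDyer.BirchSwinnertonDyer.Theses.SemiOrdinaryEisensteinDescent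
  Summit.BirchSwinnertonDyer.BirchSwinnertonDyer.Theorems
  Summit.BirchSwinnertonDyer.BirchSwinnertonDyer.Theorems.WildKolyvaginUpperAtThreeTowerFree
  Summit.BirchSwinnertonDyer.BirchSwinnertonDyer.Theorems.EisensteinKernelAtThreeTowerFree

/-- MIRROR of the restated crux Ko′ = item 20480's text with `TowerSurjThree W →` deleted. [folklore] -/
def KoPrime : Prop :=
  ∀ (W : WeierstrassCurve ℚ) [W.IsElliptic] [W.IsGloballyMinimal] (N : ℕ) [NeZero N] (K : Type) [Field K] [NumberField K] (Dt : Literature.NumberTheory.EllipticCurves.ModularForms.ModularParametrizationData W N) (H : Literature.NumberTheory.EllipticCurves.HeegnerDatum N (NumberField.discr K)) (ι : K →+* ℂ) (P : (W.baseChange K).toAffine.Point), Summit.BirchSwinnertonDyer.Rank1Residual.Additive.ClassO6 W 3 → W.HasSurjectiveModNGaloisRep 3 → W.analyticRank = 1 → W.conductorNorm ℤ = N → Literature.NumberTheory.EllipticCurves.IsImaginaryQuadratic K → Literature.NumberTheory.EllipticCurves.SatisfiesHeegnerHypothesis N K → (W.quadraticTwist (NumberField.discr K : ℚ)).entireLFunction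 1 ≠ 0 → (WeierstrassCurve.Affine.Point.map ι.toRatAlgHom) P = Literature.NumberTheory.EllipticCurves.ModularForms.heegnerPointComplex Dt H → ¬ IsOfFinAddOrder P → Odd (NumberField.discr K) → NumberField.discr K ≠ -3 → Summit.BirchSwinnertonDyer.BirchSwinnertonDyer.Theorems.SchneiderFree.Upper.IndexUpperBoundLeAt W 3 K P (padicValNat 3 Dt.c.natAbs)

/-- MIRROR of the restated crux J′ = item 20760's text with `TowerSurjThree W →` deleted. [folklore] -/
def JPrime : Prop :=
  ∀ (W : WeierstrassCurve ℚ) [W.IsElliptic] [W.IsGloballyMinimal] (N : ℕ) [NeZero N] (K : Type) [Field K] [NumberField K] (Dt : Literature.NumberTheory.EllipticCurves.ModularForms.ModularParametrizationData W N) (H : Literature.NumberTheory.EllipticCurves.HeegnerDatum N (NumberField.discr K)) (ι : K →+* ℂ) (P : (W.baseChange K).toAffine.Point), Summit.BirchSwinnertonDyer.Rank1Residual.Additive.ClassO6 W 3 → W.HasSurjectiveModNGaloisRep 3 → W.analyticRank = 1 → W.conductorNorm ℤ = N → Literature.NumberTheory.EllipticCurves.IsImaginaryQuadratic K → Literature.NumberTheory.EllipticCurves.SatisfiesHeegnerHypothesis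 N K → (W.quadraticTwist (NumberField.discr K : ℚ)).entireLFunction 1 ≠ 0 → (WeierstrassCurve.Affine.Point.map ι.toRatAlgHom) P = Literature.NumberTheory.EllipticCurves.ModularForms.heegnerPointComplex Dt H → ¬ IsOfFinAddOrder P → Odd (NumberField.discr K) → NumberField.discr K ≠ -3 → ∀ (s' : ℕ), s' ≤ padicValNat 3 W.tamagawaProduct + padicValNat 3 Dt.c.natAbs → ∀ (n : ℕ) (d : Literature.NumberTheory.EllipticCurves.KolyvaginHeegnerData Dt H.β ι n), Squarefree n → (∀ ℓ ∈ n.primeFactors, Literature.NumberTheory.EllipticCurves.Zhang2014.IsKolyvaginPrime N W K 3 ℓ ∧ s' ≤ Literature.NumberTheory.EllipticCurves.Zhang2014.kolyvaginIndex W 3 ℓ) → Summit.BirchSwinnertonDyer.Rank1Residual.X11b.Three.Koly.PDiv d 3 s'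

/-- MIRROR of the print support child (= line birth v4's `stub_inputsPrim`). [folklore] -/
def PrimInputs : Prop :=
  (∀ (K : Type) [Field K] [NumberField K], Literature.NumberTheory.EllipticCurves.casselsTate_levelInputs K) ∧
    Literature.NumberTheory.EllipticCurves.GrossLMS1991.prop37_2_frobeniusCongruence ∧
    Literature.NumberTheory.EllipticCurves.Gross1991_heegnerPoint_sub_ratTorsion_mem_E0

/-- MIRROR of the re-glue of Ko's split: J′ → PrimInputs → Ko′. [folklore] -/
def KoPrimeOfSigma : Prop := JPrime → PrimInputs → KoPrime

/-- MIRROR of the tower-free kernel item: PUB → E′ → Ko′ → V → C → Z → leaf (NO NT socket). [folklore] -/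
def KernelPrime : Prop :=
  PublishedInputsWildThree → WildSplitEisensteinInclusionAtThreeRestricted → KoPrime → WildSplitWaldspurgerAtThree →
    WildSplitControlAtThree → WildRankZeroTwistAtThree → Summit.BirchSwinnertonDyer.WAllExclAddWildRankOneSurj

/-- Glue closer (one line over p594241). [folklore] -/
theorem koPrimeOfSigma_proof : KoPrimeOfSigma := fun hJ' h ↦
  koTowerFree_of_sigmaTowerFree_of_threePrimitives h.1 h.2.1 h.2.2 hJ'

/-- Kernel′ closer (one line over p594519). [folklore] -/
theorem kernelPrime_proof : KernelPrime := fun hIn hE' hKo' hV hC hZ ↦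
  wAllExclAddWildRankOneSurj_of_koTowerFree hIn hE' hKo' hV hC hZ

/-- NT (item 20484 AS TYPED) derived from the restated items (one line over p594519) — the aside's closer. [folklore] -/
theorem nonTower_of_items (hIn : PublishedInputsWildThree) (hE' : WildSplitEisensteinInclusionAtThreeRestricted)
    (hKo' : KoPrime) (hV : WildSplitWaldspurgerAtThree) (hC : WildSplitControlAtThree) (hZ : WildRankZeroTwistAtThree) :
    WildRankOneSurjNonTowerAtThree :=
  wildRankOneSurjNonTowerAtThree_of_koTowerFree hIn hE' hKo' hV hC hZ

/-- Ko (item 20480 AS TYPED) from Ko′ (trivial weakening) — for a twin/aside if the pen keeps Ko. [folklore] -/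
theorem ko_of_koPrime (hKo' : KoPrime) : WildKolyvaginUpperAtThree :=
  fun W _ _ N _ K _ _ Dt H ι P hO6 hs hr hN hK hH hL hP hnt hodd h3 _ ↦ hKo' W N K Dt H ι P hO6 hs hr hN hK hH hL hP hnt hodd h3

/-- `closes′` : the restated route's deciding theorem (every binder consumed). [folklore] -/
theorem closesPrime (hIn : PublishedInputsWildThree) (hE' : WildSplitEisensteinInclusionAtThreeRestricted) (hKo' : KoPrime)
    (hV : WildSplitWaldspurgerAtThree) (hC : WildSplitControlAtThree) (hZ : WildRankZeroTwistAtThree) (hK' : KernelPrime) :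
    Summit.BirchSwinnertonDyer.WAllExclAddWildRankOneSurj :=
  hK' hIn hE' hKo' hV hC hZ

/-- The whole leaf from the RESEARCH inputs {J′, E′, V, C, Z} + PUB + print (one line over p594878). [folklore] -/
theorem leaf_of_research (hIn : PublishedInputsWildThree) (hE' : WildSplitEisensteinInclusionAtThreeRestricted) (hJ' : JPrime)
    (hV : WildSplitWaldspurgerAtThree) (hC : WildSplitControlAtThree) (hZ : WildRankZeroTwistAtThree) (h : PrimInputs) :
    Summit.BirchSwinnertonDyer.WAllExclAddWildRankOneSurj :=
  wAllExclAddWildRankOneSurj_of_sigmaTowerFree_of_threePrimitives hIn hE' hJ' hV hC hZ h.1 h.2.1 h.2.2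

end Summit.BirchSwinnertonDyer.BirchSwinnertonDyer.Cruxes.WildKolyvaginUpperAtThree.SketchRestateTowerFree

end
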